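import Literature.MathematicalPhysics.QuantumFieldTheory.Balaban1983to89.B9Letters313AtOneDv
import Literature.MathematicalPhysics.QuantumFieldTheory.Balaban1983to89.B9SectDL2Decay

/-!
# `Balaban1983to89.B9BlockL2ReblockEngine` — THE L² RE-BLOCKING ENGINE: a torus block-L²-bounded real operator after ANY source map spread near one
# block, read on the N06 certificate's index-bond block map `bI` (the `L²` twin of dag-n06-h's `B9LettersHAtOneG0` §5 and of
# `B9Letters313AtOneDv.hasMajorantHom_comp_gradK_sIK_bI`)

T. Bałaban, *Propagators for lattice gauge theories in a background field*, Commun. Math. Phys. **99** (1985) 389–434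
[`Balaban1985BackgroundPropagators`, "B9"]; [4] = T. Bałaban, *Propagators and renormalization transformations for lattice gauge
theories. II*, Commun. Math. Phys. **96** (1984) 223–250 [`Balaban1984PropagatorsII`].

statement-level skeleton of published theorems with citation tags; proofs where landed; nothing here is a claim about the Yang–Mills mass gap

THE PRINTED LOCI (verbatim).  [4] (2.51)–(2.54) pp. 232–233 (block majorants, the decomposition `ν = Σ_y Δ(y)ν`, block `L²` norms), Lemma 2.1 (2.61) p. 234
(`sup_y Σ_{y′} e^{−αδ₀d(y,y′)} ≤ c₁(α)`), (2.45)–(2.46) p. 231 (`𝔅`, neighbouring blocks); [B9] (3.46) p. 398, p. 398 (remark after (3.47)).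

THE POINT.  The block-L² letters of dag-n06-l's `Letters313L2PZ ∕ L2MZ` (the N06 certificate's `hLL2`) live on dag-n06-d's coordinate carriers with the
index-bond block maps `blkBK bI ∕ blkHK ∕ blkSK (sIK bI)`; [4] (2.140) lives on the torus blocks (`blkV1`; sibling `B9Prop26L2AtPinsOne.blockBd_Gop_kIdx`).
THIS FILE bridges the two in `L²`: ★ `bl2_apply_le_of_near` — if `T` has the torus block-L² bound `C·ηᵐL^{mj(y)}·e^{−δd_T}` and `v` vanishes off the
blocks within `r` of `y₀`, then `‖1_{Δ(y)}Tv‖ ≤ C·ηᵐL^{mj(y)}·c·e^{¾δr}·e^{−¾δd_T(y,y₀)}·‖v‖` ((2.52) summed by (2.61) at a quarter of the rate); ★★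
`blockBd_comp_reblock` — for ANY real source map `S` from a carrier `(V, blkV)` whose images of fibre-supported inputs are spread `≤ r` around the carrier
block and have flat norm `≤ κ(a′)·(fibre size)`, `T ∘ S : (V, blkV) → (bonds, bI)` has the block-L² bound
`C·c·e^{¾δ(r+1)}·√(e^{δ∕4}c)·(Lʲη)(a)ᵐ·e^{−¾δd(a,a′)}·κ(a′)` for a LEVEL- and 1-FAITHFUL `bI` (`hlev`, `hβ1`: the `bI`-fibre of `a` lies in the `≤ e^{δ∕4}c` torus
blocks of level `j(a)` within distance `1` of the carrier block — `card_near_le`, `bsq_bI_le_sum_near`, `bsq_blockPiece_bI_le`).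

HONEST SCOPE.  Block-L² bookkeeping over r1's `bsq ∕ bl2 ∕ BlockBd` and p21's Lemma 2.1 (by name); nothing of [B9] or [4] asserted.  COUNT-NEUTRAL; N06 is
NOT discharged; one finite lattice at a time; nothing continuum, nothing about the mass gap.  Cell `pub-ymgap` (HUMAN RULING D-0062 ∕ D-0149), Track A node
N06 [B9], rows 20–21 JSAT lane, width seat `pub-ymgap-dag-n06-w3` (g2), 2026-08-28.
-/

noncomputable section

namespace Literature.MathematicalPhysics.QuantumFieldTheory.Balaban1983to89.B9BlockL2ReblockEngine

open B6MultiLevelTorusOperator (TDomains) open B6Geom246MultiLevelTorus (geomT) open B6GlobalChartV1 (PV blkV1 boxEquiv toBox)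
open B6KLevelCensusIndexV1 (KIdx kGeo kGeoG) open B6Prop26Census2136KLevelV1 (Gop supIn kG l2Of) open B6RandomWalk (HasMajorant BlockSupp blockPiece sum_blockPiece)
open B6RandomWalkHom (HasMajorantHom) open B6GradLegKLevelV1 (DV) open B6LapLegKLevelV1 (DVa DVa_apply LapV) open B6 (pref6)
open B6Ineq2142KLevelV1 (lvl β) open B6Ineq288MultiLevelTorus (dist_symm_geoBT) open B9Thm314GpFlatMultiLevelTorus (consts_260_261)
open B6Lemma21Repaired (Ineq261With) open B9GeoNormsKLevelV1 (geo9K) open B9GeoLemma21KLevelV1 (one_le_Mh geo9K_len_pos geo9K_dist_comm geo9K_M_nonneg)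
open B9Ineq349SiteComposite (distB distB_nonneg) open B9Ineq349SiteFromBlocks (distB_triangle) open B9Thm39ReadingCoords (cR39 cR39_nonneg)
open B9CoReadingCoords B9CoReadingCoordsH open B9CoReadingCoordsS (XSK blkSK sIK blkV1_site) open B9Thm34Ext (toB6) open B9SectDL2Decay (bsq bl2 BlockBd)
open B9PinCarriersNonVacuity (l2Of_nonneg) open Node00 Node00.OpsYSectDCoords
open scoped Matrix

variable {d ℓ : ℕ} {hd : 1 ≤ d + 1} {hL : Odd (ℓ + 1) ∧ 1 < ℓ + 1} {b₀ b₁ : ℝ}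

/-! ## §2 The L² re-blocking engine: a block-bounded real operator on a source spread near one torus block, read on the torus blocks and on the
certificate's index-bond block map `bI` (level- and 1-faithful) -/

section Reblock

variable (i : KIdx d ℓ hd hL b₀ b₁)

/-- the block-L² size of a finite sum is at most the sum of the sizes (Minkowski on a block, the bookkeeping of (2.54)). [cite: Balaban1984PropagatorsII, (2.54) p.233, bookkeeping] -/
theorem bl2_sum_le {X : Type} [Fintype X] {G : B6.Geometry} (blk : X → G.Site) (y : G.Site) {ι : Type} (s : Finset ι) (F : ι → X → ℝ) :
    bl2 blk y (∑ j ∈ s, F j) ≤ ∑ j ∈ s, bl2 blk y (F j) := by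
  classical
  induction s using Finset.induction_on with
  | empty =>
      simp only [Finset.sum_empty]
      have : bl2 blk y (0 : X → ℝ) = 0 := by
        unfold bl2 bsq; simp
      rw [this]
  | insert j s hj ih =>
      rw [Finset.sum_insert hj, Finset.sum_insert hj]
      exact (B9SectDL2Decay.bl2_add_le blk y _ _).trans (by linarith)

/-- one block's L² size is at most the total flat `L²` norm (print's `‖J‖` on the right of (2.140)). [cite: Balaban1984PropagatorsII, (2.140) p.247, bookkeeping] -/
theorem bl2_le_l2n {X : Type} [Fintype X] {G : B6.Geometry} (blk : X → G.Site) (B : G.Site) (v : X → ℝ) :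
    bl2 blk B v ≤ Real.sqrt (∑ z, v z ^ 2) := by
  letI : Fintype G.Site := G.fin
  unfold bl2
  apply Real.sqrt_le_sqrt
  rw [← B9SectDL2Decay.sum_bsq blk v]
  exact Finset.single_le_sum (fun B' _ => B9SectDL2Decay.bsq_nonneg blk B' v) (Finset.mem_univ B)

/-- the torus-block piece (2.52) of a function vanishing off the blocks within `r` of `y₀` is zero on any farther block. [cite: Balaban1984PropagatorsII, (2.52) p.232, bookkeeping] -/
theorem blockPiece_eq_zero_of_far {y₀ B : BlkY i} {r : ℝ} {v : FBondY i → ℝ}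
    (hsupp : ∀ z, v z ≠ 0 → distB i y₀ (blkV1 i.hN i.D z) ≤ r) (hB : ¬ distB i y₀ B ≤ r) :
    blockPiece (g := geomT i.D) (blkV1 i.hN i.D) B v = 0 := by
  classical
  funext z
  rw [Pi.zero_apply]
  unfold blockPiece
  split_ifs with hz
  · by_contra hvz
    exact hB (hz ▸ hsupp z hvz)
  · rfl

/-- ★ **A BLOCK-L²-BOUNDED OPERATOR ON A SOURCE SPREAD NEAR ONE BLOCK** (the L² twin of dag-n06-h's `abs_apply_le_of_near`: (2.52) summed by Lemma 2.1 (2.61)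
at a quarter of the rate): if `T` has the torus block-L² bound `C·ηᵐL^{mj(y)}·e^{−δd_T(y,y′)}` and `v` vanishes off the blocks within `r` of `y₀`, then
`‖1_{Δ(y)}Tv‖ ≤ C·ηᵐL^{mj(y)}·c·e^{¾δr}·e^{−¾δ·d_T(y, y₀)}·‖v‖`. [cite: Balaban1984PropagatorsII, (2.51)–(2.54) pp.232–233, Lemma 2.1 (2.61) p.234] -/
theorem bl2_apply_le_of_near {T : Module.End ℝ (FBondY i → ℝ)} {C δ : ℝ} (hC : 0 ≤ C) (hδ : 0 ≤ δ) (m : ℕ)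
    (hT : BlockBd (g := geomT i.D) (blkV1 i.hN i.D) (blkV1 i.hN i.D) T
      (fun y y' => C * |i.cf|⁻¹ ^ m * ((ℓ : ℝ) + 1) ^ (m * y.1.1) * Real.exp (-(δ * (geomT i.D).dist y y'))))
    {c : ℝ} (h261 : Ineq261With c (geomT i.D) δ (1 / 4)) (y₀ : BlkY i) {r : ℝ}
    (v : FBondY i → ℝ) (hsupp : ∀ z, v z ≠ 0 → distB i y₀ (blkV1 i.hN i.D z) ≤ r) (y : BlkY i) :
    bl2 (g := geomT i.D) (blkV1 i.hN i.D) y (T v) ≤ C * |i.cf|⁻¹ ^ m * ((ℓ : ℝ) + 1) ^ (m * y.1.1) * c * Real.exp (3 / 4 * δ * r) *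
      Real.exp (-(3 / 4 * δ * distB i y y₀)) * Real.sqrt (∑ z, v z ^ 2) := by
  classical
  have hv : v = ∑ B, blockPiece (g := geomT i.D) (blkV1 i.hN i.D) B v := (sum_blockPiece (g := geomT i.D) (blkV1 i.hN i.D) v).symm
  have hT' : T v = ∑ B, T (blockPiece (g := geomT i.D) (blkV1 i.hN i.D) B v) := by
    conv_lhs => rw [hv]
    rw [map_sum]
  set w : ℝ := C * |i.cf|⁻¹ ^ m * ((ℓ : ℝ) + 1) ^ (m * y.1.1) with hw
  have hw0 : 0 ≤ w := by positivity
  set nv : ℝ := Real.sqrt (∑ z, v z ^ 2) with hnv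
  have hnv0 : 0 ≤ nv := Real.sqrt_nonneg _
  have hterm : ∀ B : BlkY i, bl2 (g := geomT i.D) (blkV1 i.hN i.D) y (T (blockPiece (g := geomT i.D) (blkV1 i.hN i.D) B v)) ≤
      w * nv * Real.exp (3 / 4 * δ * r) * Real.exp (-(3 / 4 * δ * distB i y y₀)) * Real.exp (-(1 / 4 * δ * distB i y B)) := by
    intro B
    by_cases hB : distB i y₀ B ≤ r
    · have hpc : ∀ z, blkV1 i.hN i.D z ≠ B → blockPiece (g := geomT i.D) (blkV1 i.hN i.D) B v z = 0 := fun z hz => by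
        unfold blockPiece
        split_ifs with h'
        · exact absurd h' hz
        · rfl
      have h1 := hT B _ hpc y
      rw [B9SectDL2Decay.bl2_blockPiece_self] at h1
      have h2 : bl2 (g := geomT i.D) (blkV1 i.hN i.D) B v ≤ nv := bl2_le_l2n _ _ _
      have htri : distB i y y₀ ≤ distB i y B + r := by
        have t := distB_triangle i y B y₀
        have hs : distB i B y₀ = distB i y₀ B := dist_symm_geoBT (toKT i) _ _
        linarith
      have hexp : Real.exp (-(δ * (geomT i.D).dist y B)) ≤
          Real.exp (3 / 4 * δ * r) * Real.exp (-(3 / 4 * δ * distB i y y₀)) * Real.exp (-(1 / 4 * δ * distB i y B)) := by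
        rw [← Real.exp_add, ← Real.exp_add]
        refine Real.exp_le_exp.2 ?_
        change -(δ * distB i y B) ≤ _
        have h34 : 3 / 4 * δ * distB i y y₀ ≤ 3 / 4 * δ * (distB i y B + r) := mul_le_mul_of_nonneg_left htri (by positivity)
        linarith
      calc bl2 (g := geomT i.D) (blkV1 i.hN i.D) y (T (blockPiece (g := geomT i.D) (blkV1 i.hN i.D) B v))
          ≤ w * Real.exp (-(δ * (geomT i.D).dist y B)) * bl2 (g := geomT i.D) (blkV1 i.hN i.D) B v := h1
        _ ≤ w * (Real.exp (3 / 4 * δ * r) * Real.exp (-(3 / 4 * δ * distB i y y₀)) * Real.exp (-(1 / 4 * δ * distB i y B))) * nv :=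
            mul_le_mul (mul_le_mul_of_nonneg_left hexp hw0) h2 (B9SectDL2Decay.bl2_nonneg _ _ _) (by positivity)
        _ = _ := by ring
    · rw [blockPiece_eq_zero_of_far i hsupp hB, map_zero]
      have h0 : bl2 (g := geomT i.D) (blkV1 i.hN i.D) y (0 : FBondY i → ℝ) = 0 := by unfold bl2 bsq; simp
      rw [h0]
      positivity
  have h261' : ∑ B : BlkY i, Real.exp (-(1 / 4 * δ * distB i y B)) ≤ c := h261 y
  have hc0 : 0 ≤ c := le_trans (Finset.sum_nonneg fun y _ => (Real.exp_pos _).le) h261'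
  calc bl2 (g := geomT i.D) (blkV1 i.hN i.D) y (T v)
      = bl2 (g := geomT i.D) (blkV1 i.hN i.D) y (∑ B, T (blockPiece (g := geomT i.D) (blkV1 i.hN i.D) B v)) := by rw [hT']
    _ ≤ ∑ B, bl2 (g := geomT i.D) (blkV1 i.hN i.D) y (T (blockPiece (g := geomT i.D) (blkV1 i.hN i.D) B v)) := bl2_sum_le _ _ _ _
    _ ≤ ∑ B : BlkY i, w * nv * Real.exp (3 / 4 * δ * r) * Real.exp (-(3 / 4 * δ * distB i y y₀)) * Real.exp (-(1 / 4 * δ * distB i y B)) :=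
        Finset.sum_le_sum fun B _ => hterm B
    _ = w * nv * Real.exp (3 / 4 * δ * r) * Real.exp (-(3 / 4 * δ * distB i y y₀)) * ∑ B : BlkY i, Real.exp (-(1 / 4 * δ * distB i y B)) := by
        rw [Finset.mul_sum]
    _ ≤ w * nv * Real.exp (3 / 4 * δ * r) * Real.exp (-(3 / 4 * δ * distB i y y₀)) * c := mul_le_mul_of_nonneg_left h261' (by positivity)
    _ = _ := by rw [hw]; ring

/-- the number of torus blocks within distance `1` of a block is at most `e^{δ∕4}·c` (Lemma 2.1 (2.61) at a quarter of the rate). [cite: Balaban1984PropagatorsII, Lemma 2.1 (2.61) p.234, bookkeeping] -/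
theorem card_near_le {δ c : ℝ} (hδ : 0 ≤ δ) (h261 : Ineq261With c (geomT i.D) δ (1 / 4)) (y₀ : BlkY i) :
    ((Finset.univ.filter (fun B : BlkY i => distB i y₀ B ≤ 1)).card : ℝ) ≤ Real.exp (1 / 4 * δ) * c := by
  classical
  rw [show ((Finset.univ.filter (fun B : BlkY i => distB i y₀ B ≤ 1)).card : ℝ) =
      ∑ B ∈ Finset.univ.filter (fun B : BlkY i => distB i y₀ B ≤ 1), (1 : ℝ) by simp]
  calc ∑ B ∈ Finset.univ.filter (fun B : BlkY i => distB i y₀ B ≤ 1), (1 : ℝ)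
      ≤ ∑ B ∈ Finset.univ.filter (fun B : BlkY i => distB i y₀ B ≤ 1), Real.exp (1 / 4 * δ) * Real.exp (-(1 / 4 * δ * distB i y₀ B)) :=
        Finset.sum_le_sum fun B hB => by
          have hB' : distB i y₀ B ≤ 1 := (Finset.mem_filter.1 hB).2
          rw [← Real.exp_add]
          have : 0 ≤ 1 / 4 * δ + -(1 / 4 * δ * distB i y₀ B) := by nlinarith
          calc (1 : ℝ) = Real.exp 0 := (Real.exp_zero).symm
            _ ≤ _ := Real.exp_le_exp.2 this
    _ ≤ ∑ B : BlkY i, Real.exp (1 / 4 * δ) * Real.exp (-(1 / 4 * δ * distB i y₀ B)) :=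
        Finset.sum_le_sum_of_subset_of_nonneg (Finset.filter_subset _ _) fun B _ _ => by positivity
    _ = Real.exp (1 / 4 * δ) * ∑ B : BlkY i, Real.exp (-(1 / 4 * δ * distB i y₀ B)) := by rw [Finset.mul_sum]
    _ ≤ Real.exp (1 / 4 * δ) * c := mul_le_mul_of_nonneg_left (h261 y₀) (Real.exp_pos _).le

/-- the squared block-L² size over the `bI`-fibre of an index bond `a` is at most the sum of the squared torus-block sizes of the fibre piece over the
blocks within distance 1 of the carrier block of `a` (`hβ1`). [cite: Balaban1984PropagatorsII, (2.45)–(2.46) p.231, (2.52) p.232, bookkeeping] -/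
theorem bsq_bI_le_sum_near {bI : FBondY i → IBondY i}
    (hβ1 : ∀ f : FBondY i, (geomT i.D).dist (β i.hN i.D i.hk (bI f)) (blkV1 i.hN i.D f) ≤ 1) [Fintype (geo9K i).Site]
    (R₀ : ℝ) (H₀ : Prop) (a : IBondY i) (F : FBondY i → ℝ) :
    bsq (g := toB6 (geo9K i) R₀ H₀) bI a F ≤
      ∑ B ∈ Finset.univ.filter (fun B : BlkY i => distB i (β i.hN i.D i.hk a) B ≤ 1),
        bsq (g := geomT i.D) (blkV1 i.hN i.D) B (blockPiece (g := toB6 (geo9K i) R₀ H₀) bI a F) := by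
  classical
  set Fa := blockPiece (g := toB6 (geo9K i) R₀ H₀) bI a F with hFa
  have h1 : bsq (g := toB6 (geo9K i) R₀ H₀) bI a F = ∑ f, Fa f ^ 2 := by
    unfold bsq
    refine Finset.sum_congr rfl fun f _ => ?_
    rw [hFa]
    unfold blockPiece
    split_ifs <;> ring
  have h2 : ∑ f, Fa f ^ 2 = ∑ B, bsq (g := geomT i.D) (blkV1 i.hN i.D) B Fa := (B9SectDL2Decay.sum_bsq _ Fa).symm
  have h3 : ∀ B ∈ (Finset.univ : Finset (BlkY i)), B ∉ Finset.univ.filter (fun B : BlkY i => distB i (β i.hN i.D i.hk a) B ≤ 1) →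
      bsq (g := geomT i.D) (blkV1 i.hN i.D) B Fa = 0 := fun B _ hB => by
    unfold bsq
    refine Finset.sum_eq_zero fun f _ => ?_
    split_ifs with hfB
    · rw [hFa]
      unfold blockPiece
      split_ifs with hfa
      · exfalso
        apply hB
        rw [Finset.mem_filter]
        refine ⟨Finset.mem_univ _, ?_⟩
        have := hβ1 f
        rw [hfa, hfB] at this
        exact this
      · ring
    · rfl
  rw [h1, h2]
  exact le_of_eq (Finset.sum_subset (Finset.filter_subset _ _) h3).symm

/-- `ηᵐ·L^{m·j(a)} = (Lʲη)(a)ᵐ` for an index bond `a`. [cite: Balaban1985BackgroundPropagators, (3.41) p.397, bookkeeping] -/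
theorem eta_pow_mul_L_pow_eq_len_pow (m : ℕ) (a : IBondY i) :
    |i.cf|⁻¹ ^ m * ((ℓ : ℝ) + 1) ^ (m * lvl i.hN i.D i.hk a) = (geo9K i).len a ^ m := by
  rw [B9GeoNormsKLevelV1.geo9K_len_kGeo, B6KLevelCensusIndexV1.len_eq, div_eq_mul_inv, mul_pow, ← pow_mul, mul_comm]
  push_cast
  ring

/-- the fibre piece of `F` over the index bond `a` vanishes on every torus block whose level is not `j(a)` (`hlev`), and its torus-block size is at most that of
`F`. [cite: Balaban1984PropagatorsII, (2.45) p.231, (2.52) p.232, bookkeeping] -/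
theorem bsq_blockPiece_bI_le {bI : FBondY i → IBondY i} (hlev : ∀ f : FBondY i, lvl i.hN i.D i.hk (bI f) = (blkV1 i.hN i.D f).1.1)
    [Fintype (geo9K i).Site] (R₀ : ℝ) (H₀ : Prop) (a : IBondY i) (F : FBondY i → ℝ) (B : BlkY i) :
    bsq (g := geomT i.D) (blkV1 i.hN i.D) B (blockPiece (g := toB6 (geo9K i) R₀ H₀) bI a F) ≤
      (if B.1.1 = lvl i.hN i.D i.hk a then bsq (g := geomT i.D) (blkV1 i.hN i.D) B F else 0) := by
  classical
  unfold bsq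
  split_ifs with hB
  · refine Finset.sum_le_sum fun f _ => ?_
    split_ifs with hfB
    · unfold blockPiece
      split_ifs
      · exact le_rfl
      · rw [zero_pow two_ne_zero]; positivity
    · exact le_rfl
  · refine le_of_eq (Finset.sum_eq_zero fun f _ => ?_)
    split_ifs with hfB
    · unfold blockPiece
      split_ifs with hfa
      · exfalso; apply hB; rw [← hfB, ← hlev f, hfa]
      · ring
    · rfl

/-- ★★ **THE L² RE-BLOCKING ENGINE** (L² twin of dag-n06-h's `hasMajorantHom_comp_qsK_bI` and of `B9Letters313AtOneDv.hasMajorantHom_comp_gradK_sIK_bI`): a real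
operator `T` on the fine bonds with the torus block-L² bound `C·ηᵐL^{mj(y)}·e^{−δd_T}` gives, after ANY real source map `S` from a carrier `V` (block map
`blkV` into the index bonds) whose image of a `blkV`-fibre-supported input is supported within torus distance `r` of the carrier block and has flat `L²`
norm at most `κ(a′)` times the fibre size, an operator `T ∘ S : (V, blkV) → (bonds, bI)` with the block-L² bound
`C·c·e^{¾δ(r+1)}·√(e^{δ∕4}c)·(Lʲη)(a)ᵐ·e^{−¾δd(a,a′)}·κ(a′)` for a LEVEL- and 1-FAITHFUL `bI`. [cite: Balaban1984PropagatorsII, (2.51)–(2.54) pp.232–233, Lemma 2.1 (2.61) p.234, (2.45)–(2.46) p.231; Balaban1985BackgroundPropagators, (3.46) p.398, p.398 (remark after (3.47))] -/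
theorem blockBd_comp_reblock {V : Type} [Fintype V] {bI : FBondY i → IBondY i}
    (hlev : ∀ f : FBondY i, lvl i.hN i.D i.hk (bI f) = (blkV1 i.hN i.D f).1.1)
    (hβ1 : ∀ f : FBondY i, (geomT i.D).dist (β i.hN i.D i.hk (bI f)) (blkV1 i.hN i.D f) ≤ 1)
    {T : Module.End ℝ (FBondY i → ℝ)} {C δ : ℝ} (hC : 0 ≤ C) (hδ : 0 ≤ δ) (m : ℕ)
    (hT : BlockBd (g := geomT i.D) (blkV1 i.hN i.D) (blkV1 i.hN i.D) T
      (fun y y' => C * |i.cf|⁻¹ ^ m * ((ℓ : ℝ) + 1) ^ (m * y.1.1) * Real.exp (-(δ * (geomT i.D).dist y y'))))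
    {c : ℝ} (h261 : Ineq261With c (geomT i.D) δ (1 / 4)) (R₀ : ℝ) (H₀ : Prop) [Fintype (geo9K i).Site]
    {blkV : V → IBondY i} {S : (V → ℝ) →ₗ[ℝ] (FBondY i → ℝ)} {r : ℝ} {κ : IBondY i → ℝ}
    (hSsupp : ∀ (a' : IBondY i) (ω : V → ℝ), (∀ v, blkV v ≠ a' → ω v = 0) → ∀ z, S ω z ≠ 0 → distB i (β i.hN i.D i.hk a') (blkV1 i.hN i.D z) ≤ r)
    (hSnorm : ∀ (a' : IBondY i) (ω : V → ℝ), (∀ v, blkV v ≠ a' → ω v = 0) →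
      Real.sqrt (∑ z, S ω z ^ 2) ≤ κ a' * bl2 (g := toB6 (geo9K i) R₀ H₀) blkV a' ω) :
    BlockBd (g := toB6 (geo9K i) R₀ H₀) blkV bI (T ∘ₗ S)
      (fun a a' => C * c * Real.exp (3 / 4 * δ * (r + 1)) * Real.sqrt (Real.exp (1 / 4 * δ) * c) * (geo9K i).len a ^ m *
        Real.exp (-(3 / 4 * δ * (geo9K i).dist a a')) * κ a') := by
  classical
  intro a' ω hω a
  change IBondY i at a' a
  set F : FBondY i → ℝ := T (S ω) with hF
  have hc0 : 0 ≤ c := le_trans (Finset.sum_nonneg fun y _ => (Real.exp_pos _).le) (h261 (β i.hN i.D i.hk a))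
  set nS : ℝ := Real.sqrt (∑ z, S ω z ^ 2) with hnS
  have hnS0 : 0 ≤ nS := Real.sqrt_nonneg _
  -- the uniform bound on the near blocks of the right level
  set Kmax : ℝ := C * |i.cf|⁻¹ ^ m * ((ℓ : ℝ) + 1) ^ (m * lvl i.hN i.D i.hk a) * c * Real.exp (3 / 4 * δ * r) * Real.exp (3 / 4 * δ) *
    Real.exp (-(3 / 4 * δ * (geo9K i).dist a a')) with hKmax
  have hKmax0 : 0 ≤ Kmax := by positivity
  have hblk : ∀ B ∈ Finset.univ.filter (fun B : BlkY i => distB i (β i.hN i.D i.hk a) B ≤ 1),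
      bsq (g := geomT i.D) (blkV1 i.hN i.D) B (blockPiece (g := toB6 (geo9K i) R₀ H₀) bI a F) ≤ (Kmax * nS) ^ 2 := by
    intro B hB
    have hB1 : distB i (β i.hN i.D i.hk a) B ≤ 1 := (Finset.mem_filter.1 hB).2
    refine (bsq_blockPiece_bI_le i hlev R₀ H₀ a F B).trans ?_
    split_ifs with hBl
    · -- the torus bound at B, re-based at `β a′`
      have h1 := bl2_apply_le_of_near i hC hδ m hT h261 (β i.hN i.D i.hk a') (S ω) (hSsupp a' ω hω) B
      have htri : (geo9K i).dist a a' ≤ 1 + distB i B (β i.hN i.D i.hk a') := by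
        change distB i (β i.hN i.D i.hk a) (β i.hN i.D i.hk a') ≤ _
        linarith [distB_triangle i (β i.hN i.D i.hk a) B (β i.hN i.D i.hk a')]
      have hexp : Real.exp (-(3 / 4 * δ * distB i B (β i.hN i.D i.hk a'))) ≤
          Real.exp (3 / 4 * δ) * Real.exp (-(3 / 4 * δ * (geo9K i).dist a a')) := by
        rw [← Real.exp_add]; exact Real.exp_le_exp.2 (by nlinarith [mul_le_mul_of_nonneg_left htri (show (0:ℝ) ≤ 3 / 4 * δ by positivity)])
      have h2 : bl2 (g := geomT i.D) (blkV1 i.hN i.D) B F ≤ Kmax * nS := by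
        rw [hF]
        refine h1.trans ?_
        rw [hBl, hKmax]
        have h0 : 0 ≤ C * |i.cf|⁻¹ ^ m * ((ℓ : ℝ) + 1) ^ (m * lvl i.hN i.D i.hk a) * c * Real.exp (3 / 4 * δ * r) := by positivity
        calc C * |i.cf|⁻¹ ^ m * ((ℓ : ℝ) + 1) ^ (m * lvl i.hN i.D i.hk a) * c * Real.exp (3 / 4 * δ * r) *
              Real.exp (-(3 / 4 * δ * distB i B (β i.hN i.D i.hk a'))) * nS
            ≤ C * |i.cf|⁻¹ ^ m * ((ℓ : ℝ) + 1) ^ (m * lvl i.hN i.D i.hk a) * c * Real.exp (3 / 4 * δ * r) *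
              (Real.exp (3 / 4 * δ) * Real.exp (-(3 / 4 * δ * (geo9K i).dist a a'))) * nS :=
              mul_le_mul_of_nonneg_right (mul_le_mul_of_nonneg_left hexp h0) hnS0
          _ = _ := by ring
      calc bsq (g := geomT i.D) (blkV1 i.hN i.D) B F = bl2 (g := geomT i.D) (blkV1 i.hN i.D) B F ^ 2 := (B9SectDL2Decay.bl2_sq _ _ _).symm
        _ ≤ (Kmax * nS) ^ 2 := pow_le_pow_left₀ (B9SectDL2Decay.bl2_nonneg _ _ _) h2 2
    · positivity
  -- sum over the near blocks, count them, take the root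
  have hcard := card_near_le i hδ h261 (β i.hN i.D i.hk a)
  have hsum : bsq (g := toB6 (geo9K i) R₀ H₀) bI a F ≤ (Real.exp (1 / 4 * δ) * c) * (Kmax * nS) ^ 2 := by
    refine (bsq_bI_le_sum_near i hβ1 R₀ H₀ a F).trans ?_
    refine (Finset.sum_le_sum hblk).trans ?_
    rw [Finset.sum_const, nsmul_eq_mul]
    exact mul_le_mul_of_nonneg_right hcard (sq_nonneg _)
  have hroot : bl2 (g := toB6 (geo9K i) R₀ H₀) bI a F ≤ Real.sqrt (Real.exp (1 / 4 * δ) * c) * (Kmax * nS) := by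
    unfold bl2
    calc Real.sqrt (bsq (g := toB6 (geo9K i) R₀ H₀) bI a F) ≤ Real.sqrt ((Real.exp (1 / 4 * δ) * c) * (Kmax * nS) ^ 2) := Real.sqrt_le_sqrt hsum
      _ = Real.sqrt (Real.exp (1 / 4 * δ) * c) * (Kmax * nS) := by
          rw [Real.sqrt_mul (by positivity), Real.sqrt_sq (by positivity)]
  have hfinal : Real.sqrt (Real.exp (1 / 4 * δ) * c) * (Kmax * nS) ≤
      C * c * Real.exp (3 / 4 * δ * (r + 1)) * Real.sqrt (Real.exp (1 / 4 * δ) * c) * (geo9K i).len a ^ m *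
        Real.exp (-(3 / 4 * δ * (geo9K i).dist a a')) * κ a' * bl2 (g := toB6 (geo9K i) R₀ H₀) blkV a' ω := by
    have hn := hSnorm a' ω hω
    calc Real.sqrt (Real.exp (1 / 4 * δ) * c) * (Kmax * nS) = (Real.sqrt (Real.exp (1 / 4 * δ) * c) * Kmax) * nS := by ring
      _ ≤ (Real.sqrt (Real.exp (1 / 4 * δ) * c) * Kmax) * (κ a' * bl2 (g := toB6 (geo9K i) R₀ H₀) blkV a' ω) :=
          mul_le_mul_of_nonneg_left hn (by positivity)
      _ = _ := by
          rw [hKmax, ← eta_pow_mul_L_pow_eq_len_pow i m a, show 3 / 4 * δ * (r + 1) = 3 / 4 * δ * r + 3 / 4 * δ by ring, Real.exp_add]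
          ring
  exact hroot.trans hfinal

end Reblock

end Literature.MathematicalPhysics.QuantumFieldTheory.Balaban1983to89.B9BlockL2ReblockEngine

end
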